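import Mathlib
import HarnessLib
import Summits.NavierStokesRegularity.NavierStokesRegularity.Theorems.PoloidalWindowDoorPoloidalWindowRigidityUntwistedDynamics

/-!
# Route `PoloidalWindowDoor`, crux `PoloidalWindowRigidity` (K2, stmt-NavierStokesRegularity-19708), skeleton `lrc-jet` v5,
# stub `stub_twisting` — brick: THE GENERAL (TWISTING-ALLOWED) NS₃ NORMAL FORM {(K1), (V0)} NEAR ANY NON-DEGENERATE POINT

Cell ns-regularity-ideate, seat ns-poloidal-K2-p2 (gen 5; stub-worker under the K2 lead ns-poloidal-K2-p1 g6; `--supports stmt-NavierStokesRegularity-19708`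
helper).  After brick F2 (`…StructureFunctionDynamics`, `…StructureFunctionNormalForm`, `…UntwistedDynamics{,Analytic}`: the normal form of the UNTWISTED
stratum, which closes `stub_untwisted` with the lead's assembly core) the crux's only remaining registered stub is the research residue `stub_twisting`.
Its handles (`Cruxes/PoloidalWindowRigidity/UNTWISTED-NOTE.md` §5) start from the pressure-free normal form of §1 — (K1) `ΛΔₕw + Λ_w|∇ₕw|² + w_zz = 0` and
(V0) `(1−Λ)(wₜ + v·∇w) = (1−Λ)Δw − Λ_w|∇w|² − 2Λ_z w_z − K(w,z,t)` — which hold on EVERY non-degenerate window, twisting or not.  Because the key step of F2a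
(`{T, v₂}ₕ = 0`: the dynamic scalar `T = ∂ₜψ + (v·∇)ψ − Δψ` is leafwise) uses no untwistedness, both are now kernel theorems in full generality:

* `fderiv_dirPartial_symm` — Clairaut on `ℝ × ℝ` at a point (`C²` at `p` ⇒ mixed directional partials agree).
* `divIdentity_general` — **(K1) without untwistedness:** `V ∈ C²` divergence-free with `∂₂V_b = Λ(V₂,y₂)∂_bV₂` (`b = 0,1`) on an open `U` ⇒
  `Λ·(∂₀∂₀w + ∂₁∂₁w) + Λ_w·((∂₀w)² + (∂₁w)²) + ∂₂∂₂w = 0` on `U` (`w = V₂`).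
* `dynIdentity_general` — **(V0) without untwistedness, pointwise:** with the Clebsch pair, `ψ = F(w,y₂)` on `U` (`F ∈ C²` at the leaf points), the chain rules
  at `y` and `T(t,y) = τ(w y, y₂)`:  `(1−Λ)·(∂ₜw + Dw[v] − Δw) = −Λ_w·Σᵢ(∂ᵢw)² − 2Λ_z·∂₂w − K`,  `Λ = 1 − F_w`, `K = F_t + w·F_z − F_zz − τ` — §1 (V0) VERBATIM
  (the `2Λ_z` by Clairaut `F_wz = F_zw`).
* `normalForm_general` — **packaged:** class profile, poloidal, `t < 0`, `∇ₕv₂(t,y₀) ≠ 0`, order `n` ⇒ `∃` open `U ∋ y₀` and `Λ, K : ℝ × ℝ → ℝ` of class `Cⁿ` at the leaf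
  points with (slope) `∂₂v_b = Λ(w,y₂)∂_bw`, (K1) and (V0) on `U`.  Consumers: the twisting census (cert-1), the structural engine (nsreg-p7) and any Lean attack
  on `stub_twisting` (the remaining equations of §5 — `curlₕvₕ = 0`, `divₕvₕ = −∂₂w`, `β_z = −αγ` — are kinematic).

WHAT THIS IS NOT: not a claim about Navier–Stokes regularity and not the stub — its starting normal form (bears_on LADDER-NS N0 via crux K2 = stmt-19708).
-/

noncomputable section

-- the summit and its single sub-problem share the name (CONVENTIONS §1), as in every Theorems file
set_option linter.dupNamespace false

namespace Summit.NavierStokesRegularity.NavierStokesRegularity.Theorems.PoloidalWindowDoorPoloidalWindowRigidityStructureFunctionNormalFormTwisting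

open Set Function Filter Topology Metric
open scoped RealInnerProductSpace InnerProductSpace Laplacian ContDiff
open Literature.Analysis Literature.Analysis.FluidPDE Literature.Analysis.Calculus
open Summit.NavierStokesRegularity.NavierStokesRegularity.Theorems.LocalSineTubeDoorProfileAlignedWindowRigidityAncient
open Summit.NavierStokesRegularity.NavierStokesRegularity.Theorems.PoloidalWindowDoorPoloidalWindowRigidityClebsch
open Summit.NavierStokesRegularity.NavierStokesRegularity.Theorems.PoloidalWindowDoorPoloidalWindowRigidityStructureFunction
open Summit.NavierStokesRegularity.NavierStokesRegularity.Theorems.PoloidalWindowDoorPoloidalWindowRigidityStructureFunctionSlope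
open Summit.NavierStokesRegularity.NavierStokesRegularity.Theorems.PoloidalWindowDoorPoloidalWindowRigidityConstantShearMeans
open Summit.NavierStokesRegularity.NavierStokesRegularity.Theorems.PoloidalWindowDoorLrcModEntireLeafwiseVertical
open Summit.NavierStokesRegularity.NavierStokesRegularity.Theorems.PoloidalWindowDoorPoloidalWindowRigidityUntwistedSeparation
open Summit.NavierStokesRegularity.NavierStokesRegularity.Theorems.PoloidalWindowDoorPoloidalWindowRigidityUntwistedKinematics
open Summit.NavierStokesRegularity.NavierStokesRegularity.Theorems.PoloidalWindowDoorPoloidalWindowRigidityStructureFunctionDynamics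
open Summit.NavierStokesRegularity.NavierStokesRegularity.Theorems.PoloidalWindowDoorPoloidalWindowRigidityStructureFunctionNormalForm
open Summit.NavierStokesRegularity.NavierStokesRegularity.Theorems.PoloidalWindowDoorPoloidalWindowRigidityUntwistedDynamics

/-! ### Clairaut on `ℝ × ℝ` at a point -/

/-- Symmetry of the mixed directional partials of a function `G : ℝ × ℝ → ℝ` that is `C²` at `p`: `D[DG(·)u](p)v = D[DG(·)v](p)u`. [folklore] -/
theorem fderiv_dirPartial_symm {G : ℝ × ℝ → ℝ} {p : ℝ × ℝ} (hG : ContDiffAt ℝ 2 G p) (u v : ℝ × ℝ) :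
    fderiv ℝ (fun q => fderiv ℝ G q u) p v = fderiv ℝ (fun q => fderiv ℝ G q v) p u := by
  have hd : DifferentiableAt ℝ (fderiv ℝ G) p := (hG.fderiv_right (m := 1) (by norm_num)).differentiableAt one_ne_zero
  rw [fderiv_clm_apply hd (differentiableAt_const u), fderiv_clm_apply hd (differentiableAt_const v)]
  simp only [fderiv_fun_const, Pi.zero_apply, ContinuousLinearMap.comp_zero, zero_add, ContinuousLinearMap.flip_apply]
  exact (hG.isSymmSndFDerivAt (by simp)) v u

section Slice

variable {V : EuclideanSpace ℝ (Fin 3) → EuclideanSpace ℝ (Fin 3)} {Λ : ℝ × ℝ → ℝ} {U : Set (EuclideanSpace ℝ (Fin 3))}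

/-- **(K1), general form — no untwistedness.**  `V ∈ C²` divergence-free with leafwise-proportional shear `∂₂V_b = Λ(V₂,y₂)∂_bV₂` (`b = 0,1`) on an open `U`
⇒ `Λ·(∂₀∂₀w + ∂₁∂₁w) + Λ_w·((∂₀w)² + (∂₁w)²) + ∂₂∂₂w = 0` on `U` (`w = V₂`; UNTWISTED-NOTE §1 (K1) `ΛΔₕw + Λ_w|∇ₕw|² + w_zz = 0`). [folklore] -/
theorem divIdentity_general (hV : ContDiff ℝ 2 V) (hdiv : VectorCalculus.IsDivFree V) (hU : IsOpen U)
    (hΛd : ∀ y ∈ U, DifferentiableAt ℝ Λ (V y 2, y 2))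
    (hΛ : ∀ y ∈ U, ∀ b : Fin 3, b ≠ 2 →
      fderiv ℝ V y (EuclideanSpace.single 2 1) b = Λ (V y 2, y 2) * fderiv ℝ (fun x => V x 2) y (EuclideanSpace.single b (1 : ℝ)))
    {y : EuclideanSpace ℝ (Fin 3)} (hy : y ∈ U) :
    Λ (V y 2, y 2) *
        (fderiv ℝ (fun y' => fderiv ℝ (fun x => V x 2) y' (EuclideanSpace.single 0 (1 : ℝ))) y (EuclideanSpace.single 0 (1 : ℝ)) +
          fderiv ℝ (fun y' => fderiv ℝ (fun x => V x 2) y' (EuclideanSpace.single 1 (1 : ℝ))) y (EuclideanSpace.single 1 (1 : ℝ))) +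
      fderiv ℝ Λ (V y 2, y 2) (1, 0) *
        (fderiv ℝ (fun x => V x 2) y (EuclideanSpace.single 0 (1 : ℝ)) ^ 2 + fderiv ℝ (fun x => V x 2) y (EuclideanSpace.single 1 (1 : ℝ)) ^ 2) +
      fderiv ℝ (fun y' => fderiv ℝ (fun x => V x 2) y' (EuclideanSpace.single 2 (1 : ℝ))) y (EuclideanSpace.single 2 (1 : ℝ)) = 0 := by
  set w : EuclideanSpace ℝ (Fin 3) → ℝ := fun x => V x 2 with hw
  have hwc : ContDiff ℝ 2 w := contDiff_coord hV 2
  have hVb : ∀ b : Fin 3, ContDiff ℝ 2 (fun x => V x b) := fun b => contDiff_coord hV b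
  have hVd : Differentiable ℝ V := hV.differentiable (by norm_num)
  have hwd : Differentiable ℝ w := hwc.differentiable (by norm_num)
  set D0 : EuclideanSpace ℝ (Fin 3) → ℝ := fun y' => fderiv ℝ (fun x => V x 0) y' (EuclideanSpace.single 0 (1 : ℝ)) with hD0
  set D1 : EuclideanSpace ℝ (Fin 3) → ℝ := fun y' => fderiv ℝ (fun x => V x 1) y' (EuclideanSpace.single 1 (1 : ℝ)) with hD1
  set D2 : EuclideanSpace ℝ (Fin 3) → ℝ := fun y' => fderiv ℝ w y' (EuclideanSpace.single 2 (1 : ℝ)) with hD2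
  have hsum : (fun y' => D0 y' + D1 y' + D2 y') = fun _ => (0 : ℝ) := by
    funext y'
    have h := sum_fderiv_apply_eq_zero_of_isDivFree hdiv y'
    rw [← fderiv_coord_apply (hVd y') 0 (EuclideanSpace.single 0 1), ← fderiv_coord_apply (hVd y') 1 (EuclideanSpace.single 1 1),
      ← fderiv_coord_apply (hVd y') 2 (EuclideanSpace.single 2 1)] at h
    exact h
  have hD0d : DifferentiableAt ℝ D0 y := differentiableAt_partial (hVb 0) _ y
  have hD1d : DifferentiableAt ℝ D1 y := differentiableAt_partial (hVb 1) _ y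
  have hD2d : DifferentiableAt ℝ D2 y := differentiableAt_partial hwc _ y
  have hzero : fderiv ℝ D0 y (EuclideanSpace.single 2 (1 : ℝ)) + fderiv ℝ D1 y (EuclideanSpace.single 2 (1 : ℝ)) +
      fderiv ℝ D2 y (EuclideanSpace.single 2 (1 : ℝ)) = 0 := by
    have h1 : fderiv ℝ (fun y' => D0 y' + D1 y' + D2 y') y (EuclideanSpace.single 2 (1 : ℝ)) = 0 := by
      rw [hsum, fderiv_fun_const]; rfl
    have h01 : DifferentiableAt ℝ (fun y' => D0 y' + D1 y') y := hD0d.add hD1d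
    rw [fderiv_fun_add h01 hD2d, fderiv_fun_add hD0d hD1d] at h1
    simpa using h1
  have hdiag : ∀ b : Fin 3, b ≠ 2 →
      fderiv ℝ (fun y' => fderiv ℝ (fun x => V x b) y' (EuclideanSpace.single b (1 : ℝ))) y (EuclideanSpace.single 2 (1 : ℝ)) =
        Λ (V y 2, y 2) * fderiv ℝ (fun y' => fderiv ℝ w y' (EuclideanSpace.single b (1 : ℝ))) y (EuclideanSpace.single b (1 : ℝ)) +
          fderiv ℝ Λ (V y 2, y 2) (1, 0) * fderiv ℝ w y (EuclideanSpace.single b (1 : ℝ)) ^ 2 := by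
    intro b hb
    rw [fderiv_fderiv_symm (hVb b) y (EuclideanSpace.single b (1 : ℝ)) (EuclideanSpace.single 2 (1 : ℝ))]
    have hloc : (fun y' => fderiv ℝ (fun x => V x b) y' (EuclideanSpace.single 2 (1 : ℝ))) =ᶠ[𝓝 y]
        fun y' => Λ (w y', y' 2) * fderiv ℝ w y' (EuclideanSpace.single b (1 : ℝ)) := by
      filter_upwards [hU.mem_nhds hy] with y' hy'
      rw [fderiv_coord_apply (hVd y') b (EuclideanSpace.single 2 (1 : ℝ))]
      exact hΛ y' hy' b hb
    rw [hloc.fderiv_eq]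
    have hA : DifferentiableAt ℝ (fun y' : EuclideanSpace ℝ (Fin 3) => Λ (w y', y' 2)) y := differentiableAt_leaf_comp (hΛd y hy) (hwd y)
    rw [fderiv_mul_apply hA (differentiableAt_partial hwc _ y), fderiv_leaf_comp_horizontal (hΛd y hy) (hwd y) hb]
    ring
  have h0 := hdiag 0 (by decide)
  have h1 := hdiag 1 (by decide)
  change fderiv ℝ (fun y' => fderiv ℝ (fun x => V x 0) y' (EuclideanSpace.single 0 (1 : ℝ))) y (EuclideanSpace.single 2 (1 : ℝ)) +
      fderiv ℝ (fun y' => fderiv ℝ (fun x => V x 1) y' (EuclideanSpace.single 1 (1 : ℝ))) y (EuclideanSpace.single 2 (1 : ℝ)) +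
      fderiv ℝ D2 y (EuclideanSpace.single 2 (1 : ℝ)) = 0 at hzero
  rw [h0, h1] at hzero
  linear_combination hzero

end Slice

section Profile

variable {C : ℝ} {v : ℝ → EuclideanSpace ℝ (Fin 3) → EuclideanSpace ℝ (Fin 3)}

/-- **(V0), general form — no untwistedness (UNTWISTED-NOTE §1 (V0) verbatim: `(1−Λ)(wₜ + v·∇w) = (1−Λ)Δw − Λ_w|∇w|² − 2Λ_z w_z − K(w,z,t)`).**  Let `v` be a
profile of the route's Type-I class, poloidal along `e₃`, with its time-dependent Clebsch pair `φ, ψ`; `t < 0`; on an open `U` of the slice `t` the stream function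
is a structure function of the vertical velocity, `ψ(t,y) = F(v₂(t,y), y₂)` with `F ∈ C²` at the leaf points.  At a point `y ∈ U` where the time/space chain rules of
`ψ = F̃(τ, w, y₂)` hold and the dynamic scalar `T = ∂ₜψ + (v·∇)ψ − Δψ` equals `τ(w y, y₂)`, with `Λ := 1 − F_w` (so `Λ_w = −F_ww`, `Λ_z = −F_wz`):
`(1 − Λ)·(∂ₜw + Dw[v] − Δw) = −Λ_w·Σᵢ(∂ᵢw)² − 2Λ_z·∂₂w − K`,  `K = F_t + w·F_z − F_zz − τ` (at `(w y, y₂)`) — the first of the four scalar equations of the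
twisting residue (UNTWISTED-NOTE §5).  With `∂₂w = P(w,y₂)` this is `…StructureFunctionNormalForm.dynIdentity`. [folklore] -/
theorem dynIdentity_general (hrate : HasTypeITimeDecay C v)
    (hcont : ContinuousOn (uncurry v) (Iio (0 : ℝ) ×ˢ univ))
    (hmild : ∀ s t : ℝ, s < t → t < 0 → ∀ x,
      v t x = UnboundedOperators.heatExtension (v s) (t - s) x - oseenDuhamel 1 s v v t x)
    (hdiv : ∀ t < 0, VectorCalculus.IsDivFree (v t))
    (hpol : ∀ s < 0, ∀ y, ⟪curl (v s) y, EuclideanSpace.single 2 1⟫_ℝ = 0)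
    {φ ψ : ℝ → EuclideanSpace ℝ (Fin 3) → ℝ}
    (hφ : φ = fun (t : ℝ) (x : EuclideanSpace ℝ (Fin 3)) =>
      ∫ σ in (0 : ℝ)..1, ⟪v t (σ • (x - x 2 • (EuclideanSpace.single (2 : Fin 3) (1 : ℝ))) +
        x 2 • (EuclideanSpace.single (2 : Fin 3) (1 : ℝ))), x - x 2 • (EuclideanSpace.single (2 : Fin 3) (1 : ℝ))⟫_ℝ)
    (hψ : ψ = fun t y => v t y 2 - fderiv ℝ (φ t) y (EuclideanSpace.single 2 1))
    {t : ℝ} (ht : t < 0) {U : Set (EuclideanSpace ℝ (Fin 3))} (hU : IsOpen U) {F τ Λ : ℝ × ℝ → ℝ}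
    (hψF : ∀ y ∈ U, ψ t y = F (v t y 2, y 2)) (hFc : ∀ y ∈ U, ContDiffAt ℝ 2 F (v t y 2, y 2))
    (hΛF : Λ = fun q => 1 - fderiv ℝ F q (1, 0))
    {y : EuclideanSpace ℝ (Fin 3)} (hy : y ∈ U) {Ft : ℝ}
    (hDt : HasDerivAt (fun τ' => ψ τ' y) (Ft + fderiv ℝ F (v t y 2, y 2) (1, 0) * deriv (fun τ' => v τ' y 2) t) t)
    (hDx : ∀ e : EuclideanSpace ℝ (Fin 3), fderiv ℝ (ψ t) y e =
      fderiv ℝ F (v t y 2, y 2) (1, 0) * fderiv ℝ (fun x => v t x 2) y e + e 2 * fderiv ℝ F (v t y 2, y 2) (0, 1))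
    (hT : deriv (fun s => ψ s y) t + (convect (v t) (ψ t) y - Δ (ψ t) y) = τ (v t y 2, y 2)) :
    (1 - Λ (v t y 2, y 2)) *
        (deriv (fun τ' => v τ' y 2) t + fderiv ℝ (fun x => v t x 2) y (v t y) - Δ (fun x => v t x 2) y) =
      -(fderiv ℝ Λ (v t y 2, y 2) (1, 0)) * (∑ i : Fin 3, fderiv ℝ (fun x => v t x 2) y (EuclideanSpace.single i (1 : ℝ)) ^ 2) -
        2 * fderiv ℝ Λ (v t y 2, y 2) (0, 1) * fderiv ℝ (fun x => v t x 2) y (EuclideanSpace.single 2 (1 : ℝ)) -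
        (Ft + v t y 2 * fderiv ℝ F (v t y 2, y 2) (0, 1) - fderiv ℝ (fun q => fderiv ℝ F q ((0 : ℝ), (1 : ℝ))) (v t y 2, y 2) (0, 1) -
          τ (v t y 2, y 2)) := by
  obtain ⟨-, -, hslice⟩ := linePotential_pair_spec hrate hcont hmild hdiv hpol hφ hψ
  obtain ⟨-, hψsl, -⟩ := hslice t ht
  have hV : ContDiff ℝ ∞ (v t) := contDiff_slice hrate hcont hmild ht
  set w : EuclideanSpace ℝ (Fin 3) → ℝ := fun x => v t x 2 with hw
  have hw2 : ContDiff ℝ 2 w := (contDiff_coord hV 2).of_le (by norm_cast)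
  have hψ2 : ContDiff ℝ 2 (ψ t) := hψsl.of_le (by norm_cast)
  -- the Laplacian of `ψ t` through the leaf chain rule
  have hΔψ := laplacian_of_leafwise (f := ψ t) (w := w) (G := F) hU hψ2 hw2 hFc hψF hy
  -- the convective term: `D(ψ t)(y)[v] = F_w·Dw(y)[v] + v₂·F_z`
  have hconv : convect (v t) (ψ t) y = fderiv ℝ F (w y, y 2) (1, 0) * fderiv ℝ w y (v t y) + v t y 2 * fderiv ℝ F (w y, y 2) (0, 1) := by
    rw [convect_apply, hDx (v t y)]
  -- the slope function and its two partials (Clairaut for the mixed one)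
  have hΛv : Λ (w y, y 2) = 1 - fderiv ℝ F (w y, y 2) (1, 0) := by rw [hΛF]
  have hΛw : fderiv ℝ Λ (w y, y 2) (1, 0) = -fderiv ℝ (fun q => fderiv ℝ F q ((1 : ℝ), (0 : ℝ))) (w y, y 2) (1, 0) := by
    rw [hΛF, fderiv_const_sub]; rfl
  have hΛz : fderiv ℝ Λ (w y, y 2) (0, 1) = -fderiv ℝ (fun q => fderiv ℝ F q ((1 : ℝ), (0 : ℝ))) (w y, y 2) (0, 1) := by
    rw [hΛF, fderiv_const_sub]; rfl
  have hsymm : fderiv ℝ (fun q => fderiv ℝ F q ((0 : ℝ), (1 : ℝ))) (w y, y 2) (1, 0) =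
      fderiv ℝ (fun q => fderiv ℝ F q ((1 : ℝ), (0 : ℝ))) (w y, y 2) (0, 1) := (fderiv_dirPartial_symm (hFc y hy) _ _).symm
  rw [hΛv, hΛw, hΛz]
  rw [hDt.deriv, hconv, hΔψ, hsymm] at hT
  linear_combination hT


/-- **THE GENERAL NS₃ NORMAL FORM NEAR A NON-DEGENERATE POINT (twisting allowed), packaged.**  For a profile of the route's Type-I class, poloidal along `e₃`,
a time `t < 0`, a point `y₀` with `∇ₕv₂(t,y₀) ≠ 0`, and any finite order `n`: there are an open `U ∋ y₀` of the slice `t` and two functions `Λ, K : ℝ × ℝ → ℝ`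
of `(w, y₂)` (`w = v₂(t,·)`), of class `Cⁿ` at the leaf points `(w y, y₂)`, `y ∈ U`, such that on `U`:
(slope) `∂₂v_b = Λ(w,y₂)·∂_bw` (`b = 0,1`);  (K1) `Λ·(∂₀∂₀w + ∂₁∂₁w) + Λ_w·((∂₀w)² + (∂₁w)²) + ∂₂∂₂w = 0`;
(V0) `(1 − Λ)·(∂ₜw + Dw[v] − Δw) = −Λ_w·Σᵢ(∂ᵢw)² − 2Λ_z·∂₂w − K(w,y₂)`  (`Λ_w = DΛ(1,0)`, `Λ_z = DΛ(0,1)`).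
This is UNTWISTED-NOTE §1 {(K1), (V0)} in the kernel with NO untwistedness hypothesis — the starting point of the twisting residue `stub_twisting` (§5: together with
`curlₕvₕ = 0`, `divₕvₕ = −∂₂w` and the frame relation `β_z = −αγ`, four scalar equations for the one unknown `w`).  (`Λ = 1 − ∂_wF̃(t,·,·)` for K2-p3's structure
function `ψ = F̃(τ, v₂, y₂)`; `K = ∂ₜF̃ + w·F_z − F_zz − τ` with `τ` the leafwise dynamic scalar of `…StructureFunctionDynamics`.) [folklore] -/
theorem normalForm_general (n : ℕ) (hrate : HasTypeITimeDecay C v)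
    (hcont : ContinuousOn (uncurry v) (Iio (0 : ℝ) ×ˢ univ))
    (hmild : ∀ s t : ℝ, s < t → t < 0 → ∀ x,
      v t x = UnboundedOperators.heatExtension (v s) (t - s) x - oseenDuhamel 1 s v v t x)
    (hdiv : ∀ t < 0, VectorCalculus.IsDivFree (v t))
    (hpol : ∀ s < 0, ∀ y, ⟪curl (v s) y, EuclideanSpace.single 2 1⟫_ℝ = 0)
    {t : ℝ} (ht : t < 0) {y₀ : EuclideanSpace ℝ (Fin 3)}
    (hne : fderiv ℝ (v t) y₀ (EuclideanSpace.single 0 1) 2 ≠ 0 ∨ fderiv ℝ (v t) y₀ (EuclideanSpace.single 1 1) 2 ≠ 0) :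
    ∃ U : Set (EuclideanSpace ℝ (Fin 3)), IsOpen U ∧ y₀ ∈ U ∧
    ∃ Λ K : ℝ × ℝ → ℝ,
      (∀ y ∈ U, ContDiffAt ℝ n Λ (v t y 2, y 2) ∧ ContDiffAt ℝ n K (v t y 2, y 2)) ∧
      (∀ y ∈ U, ∀ b : Fin 3, b ≠ 2 →
        fderiv ℝ (v t) y (EuclideanSpace.single 2 1) b = Λ (v t y 2, y 2) * fderiv ℝ (fun x => v t x 2) y (EuclideanSpace.single b (1 : ℝ))) ∧
      (∀ y ∈ U,
        Λ (v t y 2, y 2) *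
            (fderiv ℝ (fun y' => fderiv ℝ (fun x => v t x 2) y' (EuclideanSpace.single 0 (1 : ℝ))) y (EuclideanSpace.single 0 (1 : ℝ)) +
              fderiv ℝ (fun y' => fderiv ℝ (fun x => v t x 2) y' (EuclideanSpace.single 1 (1 : ℝ))) y (EuclideanSpace.single 1 (1 : ℝ))) +
          fderiv ℝ Λ (v t y 2, y 2) (1, 0) *
            (fderiv ℝ (fun x => v t x 2) y (EuclideanSpace.single 0 (1 : ℝ)) ^ 2 + fderiv ℝ (fun x => v t x 2) y (EuclideanSpace.single 1 (1 : ℝ)) ^ 2) +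
          fderiv ℝ (fun y' => fderiv ℝ (fun x => v t x 2) y' (EuclideanSpace.single 2 (1 : ℝ))) y (EuclideanSpace.single 2 (1 : ℝ)) = 0) ∧
      (∀ y ∈ U,
        (1 - Λ (v t y 2, y 2)) *
            (deriv (fun τ' => v τ' y 2) t + fderiv ℝ (fun x => v t x 2) y (v t y) - Δ (fun x => v t x 2) y) =
          -(fderiv ℝ Λ (v t y 2, y 2) (1, 0)) * (∑ i : Fin 3, fderiv ℝ (fun x => v t x 2) y (EuclideanSpace.single i (1 : ℝ)) ^ 2) -
            2 * fderiv ℝ Λ (v t y 2, y 2) (0, 1) * fderiv ℝ (fun x => v t x 2) y (EuclideanSpace.single 2 (1 : ℝ)) - K (v t y 2, y 2)) := by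
  -- ## 0. class data
  have hanV := analyticOnNhd_uncurry hcont (bdd_of_hasTypeITimeDecay hrate) hmild
  have hmem : ((t, y₀) : ℝ × EuclideanSpace ℝ (Fin 3)) ∈ Iio (0 : ℝ) ×ˢ (univ : Set (EuclideanSpace ℝ (Fin 3))) :=
    mk_mem_prod ht (mem_univ _)
  have hslab : Iio (0 : ℝ) ×ˢ (univ : Set (EuclideanSpace ℝ (Fin 3))) ∈ 𝓝 ((t, y₀) : ℝ × EuclideanSpace ℝ (Fin 3)) :=
    (isOpen_Iio.prod isOpen_univ).mem_nhds hmem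
  have hV : ContDiff ℝ ∞ (v t) := contDiff_slice hrate hcont hmild ht
  have hVd : Differentiable ℝ (v t) := hV.differentiable (by simp)
  set N : ℕ := n + 3 with hNdef
  have hN0 : ((N : ℕ∞) : WithTop ℕ∞) ≠ 0 := by simp [hNdef]
  have hNinf : ((N : ℕ∞) : WithTop ℕ∞) ≠ ∞ := by exact_mod_cast ENat.coe_ne_top N
  -- ## 1. Clebsch pair and structure function
  obtain ⟨φ, hφ⟩ : ∃ φ : ℝ → EuclideanSpace ℝ (Fin 3) → ℝ, φ = fun (t : ℝ) (x : EuclideanSpace ℝ (Fin 3)) =>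
      ∫ σ in (0 : ℝ)..1, ⟪v t (σ • (x - x 2 • (EuclideanSpace.single (2 : Fin 3) (1 : ℝ))) +
        x 2 • (EuclideanSpace.single (2 : Fin 3) (1 : ℝ))), x - x 2 • (EuclideanSpace.single (2 : Fin 3) (1 : ℝ))⟫_ℝ := ⟨_, rfl⟩
  obtain ⟨ψ, hψ⟩ : ∃ ψ : ℝ → EuclideanSpace ℝ (Fin 3) → ℝ, ψ = fun t y => v t y 2 - fderiv ℝ (φ t) y (EuclideanSpace.single 2 1) := ⟨_, rfl⟩
  obtain ⟨hφs, hψs, hslice⟩ := linePotential_pair_spec hrate hcont hmild hdiv hpol hφ hψ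
  obtain ⟨hφsl, hψsl, hφ0, hφ1, hφ2, -, -⟩ := hslice t ht
  have hψc : ContDiffAt ℝ ((N : ℕ∞) : WithTop ℕ∞) (uncurry ψ) (t, y₀) :=
    ((hψs (t, y₀) hmem).contDiffAt hslab).of_le (by exact_mod_cast le_top)
  have hω : ∀ t < 0, ∀ y, curl (v t) y 0 = fderiv ℝ (ψ t) y (EuclideanSpace.single 1 1) ∧
      curl (v t) y 1 = -fderiv ℝ (ψ t) y (EuclideanSpace.single 0 1) := fun t' ht' y =>
    ⟨((hslice t' ht').2.2.2.2.2.1 y).1, ((hslice t' ht').2.2.2.2.2.1 y).2.1⟩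
  obtain ⟨Fst, hFc, hFeq⟩ := exists_clebsch_eq_structureFunction hN0 hrate hcont hmild hdiv hpol ht hψc hω hne
  have hgd : ∀ᶠ z in 𝓝 ((t, y₀) : ℝ × EuclideanSpace ℝ (Fin 3)), DifferentiableAt ℝ (uncurry fun t y => v t y 2) z := by
    filter_upwards [hslab] with z hz
    exact ((EuclideanSpace.proj (𝕜 := ℝ) (2 : Fin 3)).differentiableAt).comp z (hanV z hz).differentiableAt
  have hgc : ContinuousAt (uncurry fun t y => v t y 2) (t, y₀) := (hgd.self_of_nhds).continuousAt
  have hDx := fderiv_slice_eq_of_eq_structureFunction (f := ψ) (g := fun t y => v t y 2) hN0 hgd hFc hgc hFeq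
  have hDt := hasDerivAt_time_of_eq_structureFunction (f := ψ) (g := fun t y => v t y 2) hN0 hgd hFc hgc hFeq
  -- ## 2. the leafwise dynamic scalar
  obtain ⟨τ, hτc, hτeq⟩ := exists_dynScalar_eq_leafwise (n := (N : ℕ∞)) (by simp [hNdef]) hrate hcont hmild hdiv hpol hφ hψ ht
    (y₀ := y₀) hne
  -- ## 3. a spatial neighbourhood where everything holds
  have hι : Tendsto (fun y : EuclideanSpace ℝ (Fin 3) => ((t, y) : ℝ × EuclideanSpace ℝ (Fin 3))) (𝓝 y₀) (𝓝 (t, y₀)) :=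
    (continuousAt_const.prodMk continuousAt_id).tendsto
  have h1c : ContinuousAt (fun y : EuclideanSpace ℝ (Fin 3) => v t y 2) y₀ :=
    ((EuclideanSpace.proj (𝕜 := ℝ) (2 : Fin 3)).continuous.continuousAt).comp (hVd y₀).continuousAt
  have hL3 : Tendsto (fun y : EuclideanSpace ℝ (Fin 3) => ((t, v t y 2, y 2) : ℝ × ℝ × ℝ)) (𝓝 y₀) (𝓝 (t, v t y₀ 2, y₀ 2)) :=
    (continuousAt_const.prodMk (h1c.prodMk (EuclideanSpace.proj (𝕜 := ℝ) (2 : Fin 3)).continuous.continuousAt)).tendsto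
  have hL2 : Tendsto (fun y : EuclideanSpace ℝ (Fin 3) => ((v t y 2, y 2) : ℝ × ℝ)) (𝓝 y₀) (𝓝 (v t y₀ 2, y₀ 2)) := (continuousAt_leafMap h1c).tendsto
  have hall : ∀ᶠ y in 𝓝 y₀,
      ContDiffAt ℝ ((N : ℕ∞) : WithTop ℕ∞) Fst (t, v t y 2, y 2) ∧ ContDiffAt ℝ ((N : ℕ∞) : WithTop ℕ∞) τ (v t y 2, y 2) ∧
      ψ t y = Fst (t, v t y 2, y 2) ∧
      (∀ e : EuclideanSpace ℝ (Fin 3), fderiv ℝ (ψ t) y e =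
        fderiv ℝ Fst (t, v t y 2, y 2) ((0 : ℝ), (1 : ℝ), (0 : ℝ)) * fderiv ℝ (fun x => v t x 2) y e +
          e 2 * fderiv ℝ Fst (t, v t y 2, y 2) ((0 : ℝ), (0 : ℝ), (1 : ℝ))) ∧
      HasDerivAt (fun τ' => ψ τ' y) (fderiv ℝ Fst (t, v t y 2, y 2) ((1 : ℝ), (0 : ℝ), (0 : ℝ)) +
        fderiv ℝ Fst (t, v t y 2, y 2) ((0 : ℝ), (1 : ℝ), (0 : ℝ)) * deriv (fun τ' => v τ' y 2) t) t ∧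
      deriv (fun s => ψ s y) t + (convect (v t) (ψ t) y - Δ (ψ t) y) = τ (v t y 2, y 2) := by
    filter_upwards [hL3.eventually (hFc.eventually hNinf), hL2.eventually (hτc.eventually hNinf), hι.eventually hFeq, hι.eventually hDx,
      hι.eventually hDt, hτeq] with y h1 h2 h3 h4 h5 h6
    exact ⟨h1, h2, h3, h4, h5, h6⟩
  obtain ⟨U, hU, hUo, hy₀U⟩ := _root_.eventually_nhds_iff.1 hall
  -- ## 4. the slice structure functions
  set F : ℝ × ℝ → ℝ := fun q => Fst (t, q.1, q.2) with hFdef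
  set Λ : ℝ × ℝ → ℝ := fun q => 1 - fderiv ℝ F q (1, 0) with hΛdef
  set K : ℝ × ℝ → ℝ := fun q => fderiv ℝ Fst (t, q.1, q.2) ((1 : ℝ), (0 : ℝ), (0 : ℝ)) + q.1 * fderiv ℝ F q (0, 1) -
    fderiv ℝ (fun r => fderiv ℝ F r ((0 : ℝ), (1 : ℝ))) q (0, 1) - τ q with hKdef
  have hFN : ∀ y ∈ U, ContDiffAt ℝ ((N : ℕ∞) : WithTop ℕ∞) F (v t y 2, y 2) := fun y hy => contDiffAt_timeSlice (hU y hy).1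
  have hN2 : (2 : WithTop ℕ∞) ≤ ((N : ℕ∞) : WithTop ℕ∞) := by rw [WithTop.coe_natCast]; norm_cast; omega
  have hF2 : ∀ y ∈ U, ContDiffAt ℝ 2 F (v t y 2, y 2) := fun y hy => (hFN y hy).of_le hN2
  have hFstd : ∀ y ∈ U, DifferentiableAt ℝ Fst (t, v t y 2, y 2) := fun y hy => (hU y hy).1.differentiableAt (by simp [hNdef])
  have hFw : ∀ y ∈ U, fderiv ℝ Fst (t, v t y 2, y 2) ((0 : ℝ), (1 : ℝ), (0 : ℝ)) = fderiv ℝ F (v t y 2, y 2) (1, 0) := fun y hy => by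
    rw [hFdef, fderiv_timeSlice_apply (p := (v t y 2, y 2)) (hFstd y hy)]
  have hFz : ∀ y ∈ U, fderiv ℝ Fst (t, v t y 2, y 2) ((0 : ℝ), (0 : ℝ), (1 : ℝ)) = fderiv ℝ F (v t y 2, y 2) (0, 1) := fun y hy => by
    rw [hFdef, fderiv_timeSlice_apply (p := (v t y 2, y 2)) (hFstd y hy)]
  have hDx' : ∀ y ∈ U, ∀ e : EuclideanSpace ℝ (Fin 3), fderiv ℝ (ψ t) y e =
      fderiv ℝ F (v t y 2, y 2) (1, 0) * fderiv ℝ (fun x => v t x 2) y e + e 2 * fderiv ℝ F (v t y 2, y 2) (0, 1) := by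
    intro y hy e
    rw [(hU y hy).2.2.2.1 e, hFw y hy, hFz y hy]
  have hΛ' : ∀ y ∈ U, ∀ b : Fin 3, b ≠ 2 →
      fderiv ℝ (v t) y (EuclideanSpace.single 2 1) b = Λ (v t y 2, y 2) * fderiv ℝ (fun x => v t x 2) y (EuclideanSpace.single b (1 : ℝ)) := by
    intro y hy b hb
    exact shear_eq_slope_mul (hφsl.of_le (by norm_cast)) (hψsl.differentiable (by simp)) hVd hφ0 hφ1 hφ2 (hDx' y hy) hb
  have hΛd : ∀ y ∈ U, DifferentiableAt ℝ Λ (v t y 2, y 2) := fun y hy =>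
    (differentiableAt_const _).sub (differentiableAt_dirPartial (hF2 y hy) _)
  refine ⟨U, hUo, hy₀U, Λ, K, ?_, hΛ', ?_, ?_⟩
  · -- ## regularity
    intro y hy
    have hτN : ContDiffAt ℝ ((N : ℕ∞) : WithTop ℕ∞) τ (v t y 2, y 2) := (hU y hy).2.1
    have hFstN : ContDiffAt ℝ ((N : ℕ∞) : WithTop ℕ∞) Fst (t, v t y 2, y 2) := (hU y hy).1
    have e3 : (((n + 2) + 1 : ℕ) : WithTop ℕ∞) ≤ ((N : ℕ∞) : WithTop ℕ∞) := by rw [WithTop.coe_natCast]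
    have en : ((n : ℕ) : WithTop ℕ∞) ≤ ((N : ℕ∞) : WithTop ℕ∞) := by rw [WithTop.coe_natCast]; exact_mod_cast (by omega : n ≤ N)
    have en1 : ((n : ℕ) : WithTop ℕ∞) ≤ ((n + 1 : ℕ) : WithTop ℕ∞) := by exact_mod_cast Nat.le_succ n
    have en2 : ((n : ℕ) : WithTop ℕ∞) ≤ ((n + 2 : ℕ) : WithTop ℕ∞) := by exact_mod_cast (by omega : n ≤ n + 2)
    have hF3 : ContDiffAt ℝ (((n + 2) + 1 : ℕ) : WithTop ℕ∞) F (v t y 2, y 2) := (hFN y hy).of_le e3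
    have hFw1 : ContDiffAt ℝ ((n + 2 : ℕ) : WithTop ℕ∞) (fun q => fderiv ℝ F q ((1 : ℝ), (0 : ℝ))) (v t y 2, y 2) := contDiffAt_dirPartial hF3 _
    have hFz1 : ContDiffAt ℝ ((n + 2 : ℕ) : WithTop ℕ∞) (fun q => fderiv ℝ F q ((0 : ℝ), (1 : ℝ))) (v t y 2, y 2) := contDiffAt_dirPartial hF3 _
    have hFzz := contDiffAt_dirPartial (m := n + 1) hFz1 ((0 : ℝ), (1 : ℝ))
    have hFt : ContDiffAt ℝ ((n + 2 : ℕ) : WithTop ℕ∞) (fun q : ℝ × ℝ => fderiv ℝ Fst (t, q.1, q.2) ((1 : ℝ), (0 : ℝ), (0 : ℝ))) (v t y 2, y 2) := by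
      have h1 : ContDiffAt ℝ ((n + 2 : ℕ) : WithTop ℕ∞) (fderiv ℝ Fst) (t, v t y 2, y 2) :=
        (hFstN.of_le e3).fderiv_right (m := ((n + 2 : ℕ) : WithTop ℕ∞)) (by norm_cast)
      exact contDiffAt_timeSlice (G := fun r => fderiv ℝ Fst r ((1 : ℝ), (0 : ℝ), (0 : ℝ))) (h1.clm_apply contDiffAt_const)
    have h1n : ContDiffAt ℝ ((n : ℕ) : WithTop ℕ∞) (fun q : ℝ × ℝ => q.1) (v t y 2, y 2) := contDiffAt_fst
    exact ⟨contDiffAt_const.sub (hFw1.of_le en2),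
      (((hFt.of_le en2).add (h1n.mul (hFz1.of_le en2))).sub (hFzz.of_le en1)).sub (hτN.of_le en)⟩
  · -- ## (K1)
    intro y hy
    exact divIdentity_general (V := v t) (hV.of_le (by norm_cast)) (hdiv t ht) hUo hΛd hΛ' hy
  · -- ## (V0)
    intro y hy
    have hDt' : HasDerivAt (fun τ' => ψ τ' y) (fderiv ℝ Fst (t, v t y 2, y 2) ((1 : ℝ), (0 : ℝ), (0 : ℝ)) +
        fderiv ℝ F (v t y 2, y 2) (1, 0) * deriv (fun τ' => v τ' y 2) t) t := by
      rw [← hFw y hy]; exact (hU y hy).2.2.2.2.1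
    exact dynIdentity_general hrate hcont hmild hdiv hpol hφ hψ ht hUo (F := F) (τ := τ) (Λ := Λ)
      (fun y' hy' => (hU y' hy').2.2.1) hF2 rfl hy hDt' (hDx' y hy) (hU y hy).2.2.2.2.2
end Profile

end Summit.NavierStokesRegularity.NavierStokesRegularity.Theorems.PoloidalWindowDoorPoloidalWindowRigidityStructureFunctionNormalFormTwisting

end
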